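import Mathlib
import HarnessLib
import Summits.HubbardSuperconductivity.HubbardSuperconductivity.Theorems.KLProgrammeKLRegimeSectorSliceGram
import Summits.HubbardSuperconductivity.HubbardSuperconductivity.Theorems.KLProgrammeKLRegimeFatFrameInstance
import Summits.HubbardSuperconductivity.HubbardSuperconductivity.Theorems.KLProgrammeKLRegimeAlphaFatScalars2

/-!
# Route `KLProgramme` — ENGINE child (stmt-HubbardSuperconductivity-19918), `stub_engine_step_norms`: the SECTOR-RESOLVED Gram constant `κ_n`
# and the ENTRY bound of `S(Ft)ᵀ·C^K_{(Λ,Λ′]}·S(Ft)` for the FAT family `Ft = bgmFatMultiplier … (m+1)` — `κ_n² ≍ e₀·8^{-(m+1)}`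

Cell gate-hubbard-kl, seat hubbard-kl-k3c2-p3 (g3).  Companion of …SectorSliceGram (generic: Gram constant and entry bound from ONE per-sector
support count) and of the α_n chain (…SectorSliceAlphaFat / …AlphaFatClosed: row sums, BGM (2.81)).  Here the count is the FAT SECTOR's own:
`{k : Ft_ω(k) ≠ 0}` injects (`k ↦ (val⁻¹ k₁, k⃗)`) into the support of the sampled pair symbol `Ft_ω·Ft_ω` of the fat pack, counted by
`card_support_fatPair_le` — time window × rotated cell of radius `ρ_f` around `p_F(θ_ω)` — so

* `card_support_bgmFat_le` — `#{k : Ft_ω(k) ≠ 0} ≤ N_fat := (Λ_mβ/π + 1)·(√2L(Λ_m + (4+4A)ρ_f²)/(γπ) + 2)·(√2L·2ρ_f/π + 2)`, `γ = 2ρ_min − 4A`,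
  `ρ_f = (Λ_m + s_max Dt_min (3w_{m+1}/4))/(Dt_min − 2A) + π√2(1 + (4+2A)/(Dt_min − 2A))·w_{m+1}` (uniform in `ω`);
* **`isGramBoundedR_sliceCT_bgmFat`** — `IsGramBoundedR (S(Ft)ᵀ·C^K_{(Λ,Λ′]}·S(Ft)) √((βL²)⁻²·N_fat·2βL²/Λ)` (BGM (2.80), sector-resolved);
* **`norm_entry_sliceCT_bgmFat_le`** — `‖(S(Ft)ᵀ·C^K_{(Λ,Λ′]}·S(Ft)) Y Y′‖ ≤ (βL²)⁻²·N_fat·2βL²/Λ` (the sup/entry bound asked by p5 g4 for the E.5 gain);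
* **`gramConst_sq_bgmFat_closed`** — in the regime of …AlphaFatClosed (`Λ_m = 4Λ`, `Λ = klScale e₀ (m+1)`, `N_r = 2^{m+1}`, `π ≤ Λ_mβ`,
  `ρ_f ≤ c_ρπ/N_r`, the two `+2`-thresholds): `(βL²)⁻²·N_fat·2βL²/Λ ≤ 2·C_N·Λ/N_r` with `C_N = 128c₁c_ρ/(π²γ)` — i.e.
  `κ_n² ≤ 2C_N·e₀·8^{-(m+1)}`: the `γ^{3h/2}` of (2.80), `n`-uniform constant.

Everything is proved; no definitions, no named facts.
-/

noncomputable section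

namespace Summit.HubbardSuperconductivity.HubbardSuperconductivity.Theorems.TorusFourierL2

set_option linter.dupNamespace false -- summit = problem name (single-conjunct summit), D-0017

open Set Finset Literature.MathematicalPhysics.QuantumLattice Literature.MathematicalPhysics.QuantumLattice.BandSectorCounting
open Literature.MathematicalPhysics.QuantumLattice.FermiRG Literature.Probability.LatticeModels Literature.Analysis.SpecialFunctions
open Summit.HubbardSuperconductivity.HubbardSuperconductivity.Theorems.DispersionFlow
open Summit.HubbardSuperconductivity.HubbardSuperconductivity.Theorems.KLRegimeSplit
open Summit.HubbardSuperconductivity.HubbardSuperconductivity.Theorems.KLProgrammeLegKernels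
open Summit.HubbardSuperconductivity.HubbardSuperconductivity.Theorems.PerturbedFermiCurve
open scoped Real Nat

section FatGram

open Classical

variable {L M : ℕ} [NeZero L] [NeZero M] {a b : ℝ} (B : BandBounds a b) {K : TrigPolyC4v} {A : ℝ}
  (hA : ∀ p : Momentum, ∀ j ≤ 2, ‖iteratedFDeriv ℝ j (frameShift K) p‖ ≤ A) (hADt : 2 * A < B.Dtmin)
  {μ e₀ z β : ℝ} (he : 0 < e₀) (hz : 0 < z) (hz1 : z ≤ 1) (hgap : e₀ + A + z ^ 2 < -μ) (h3 : e₀ + A - μ ≤ 3)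
  (hlo : a ≤ μ - A - e₀) (hhi : μ + A + e₀ ≤ b) (hβ : 0 < β) (hρA : 4 * A < 2 * B.rhomin)
  (m : ℕ) {d : ℝ} (hd : 0 ≤ d) (hd1 : ∀ u, |deriv (bgmCutoffSq e₀) u| ≤ d) (hd2 : ∀ u, |iteratedDeriv 2 (bgmCutoffSq e₀) u| ≤ d)

omit [NeZero L] in
/-- The sampled frequency–momentum point of the product-torus label `(val⁻¹ k₁, k⃗)` is `k` itself. -/
theorem sampledIdx_of_natCast (k : FreqMomentum L M) :
    (⟨(((fun _ : Fin 1 => (((k.1 : ℕ) : ZMod (2 * M)))) : TorusSite 1 (2 * M)) 0).val,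
        ZMod.val_lt ((((fun _ : Fin 1 => (((k.1 : ℕ) : ZMod (2 * M)))) : TorusSite 1 (2 * M)) 0))⟩ : MatsubaraIdx M) = k.1 := by
  apply Fin.ext
  simp only [ZMod.val_natCast]
  exact Nat.mod_eq_of_lt k.1.isLt

include B hA hADt he hz hz1 hgap h3 hlo hhi hβ hρA hd hd1 hd2 in
/-- **Support count of ONE fat multiplier** (uniform in the sector): `#{k : Ft_ω(k) ≠ 0} ≤ N_fat` (module docstring). The support injects
into the support of the sampled pair symbol `Ft_ω·Ft_ω` on `(ℤ/2M) × (ℤ/L)²`, counted by the fat pack's `card_support_fatPair_le`.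
[cite: BenfattoGiulianiMastropietro2006, §2.7 (2.66)] -/
theorem card_support_bgmFat_le (ω : Fin (sectorCount (m + 1))) :
    (((univ : Finset (FreqMomentum L M)).filter fun k => bgmFatMultiplier L M e₀ β (nambuXiCT L μ K) (m + 1) ω k ≠ 0).card : ℝ) ≤
      (klScale e₀ m * β / π + 1) *
        ((Real.sqrt 2 * L * ((klScale e₀ m + (4 + 4 * A) *
            ((klScale e₀ m + B.smax * B.Dtmin * (3 * sectorWidth (m + 1) / 4)) / (B.Dtmin - 2 * A) +
              π * Real.sqrt 2 * (1 + (4 + 2 * A) / (B.Dtmin - 2 * A)) * sectorWidth (m + 1)) ^ 2) / (2 * B.rhomin - 4 * A)) / π + 2) *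
          (Real.sqrt 2 * L * (2 * ((klScale e₀ m + B.smax * B.Dtmin * (3 * sectorWidth (m + 1) / 4)) / (B.Dtmin - 2 * A) +
              π * Real.sqrt 2 * (1 + (4 + 2 * A) / (B.Dtmin - 2 * A)) * sectorWidth (m + 1))) / π + 2)) := by
  have hlo' : a ≤ μ - A := by linarith only [hlo, he]
  have hhi' : μ + A ≤ b := by linarith only [hhi, he]
  have hDt : 0 < B.Dtmin - 2 * A := by linarith only [hADt]
  -- the pair objects `(ω, ω)` of the fat pack
  obtain ⟨S₁, hS₁⟩ : ∃ S₁ : Finset ℕ, S₁ = (range (sectorCount (m + 1))).filter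
      (fun ω₁ : ℕ => ∃ δ : ℤ, |δ| ≤ 1 ∧ (sectorCount (m + 1) : ℤ) ∣ ((ω₁ : ℤ) - ((ω : ℕ) : ℤ) - δ)) := ⟨_, rfl⟩
  have hS₁r : S₁ ⊆ range (sectorCount (m + 1)) := by rw [hS₁]; exact fatNbr_subset_range (m + 1) ω
  obtain ⟨Z, hZdef⟩ : ∃ Z : (Fin 2 → ℝ) → ℝ, Z = fun p => gnCutoff ((π + z) ^ 2 / π ^ 2) ((π + z) ^ 2) (p 0 ^ 2) *
      gnCutoff ((π + z) ^ 2 / π ^ 2) ((π + z) ^ 2) (p 1 ^ 2) *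
    ((radialCutoffC (1 / 2) (momToComplex p) * ∑ a' ∈ S₁, sectorWeightCirc (m + 1) ((a' : ℕ) : ℤ) (polarAngle p)) *
      (radialCutoffC (1 / 2) (momToComplex p) * ∑ b' ∈ S₁, sectorWeightCirc (m + 1) ((b' : ℕ) : ℤ) (polarAngle p))) := ⟨_, rfl⟩
  have hZ : ∀ p, Z p = gnCutoff ((π + z) ^ 2 / π ^ 2) ((π + z) ^ 2) (p 0 ^ 2) * gnCutoff ((π + z) ^ 2 / π ^ 2) ((π + z) ^ 2) (p 1 ^ 2) *
    ((radialCutoffC (1 / 2) (momToComplex p) * ∑ a' ∈ S₁, sectorWeightCirc (m + 1) ((a' : ℕ) : ℤ) (polarAngle p)) *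
      (radialCutoffC (1 / 2) (momToComplex p) * ∑ b' ∈ S₁, sectorWeightCirc (m + 1) ((b' : ℕ) : ℤ) (polarAngle p))) :=
    fun p => by rw [hZdef]
  obtain ⟨Φ, hΦdef⟩ : ∃ Φ : ℝ × (Fin 2 → ℝ) → ℂ, Φ = fun x => ((bgmCutoffSq e₀ ((16 : ℝ) ^ m * (x.1 ^ 2 + frameLevel μ K (WithLp.toLp 2 x.2) ^ 2)) *
      bgmCutoffSq e₀ ((16 : ℝ) ^ m * (x.1 ^ 2 + frameLevel μ K (WithLp.toLp 2 x.2) ^ 2)) * Z x.2 : ℝ) : ℂ) := ⟨_, rfl⟩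
  have hΦ : ∀ k₀ p, Φ (k₀, p) = ((bgmCutoffSq e₀ ((16 : ℝ) ^ m * (k₀ ^ 2 + frameLevel μ K (WithLp.toLp 2 p) ^ 2)) *
      bgmCutoffSq e₀ ((16 : ℝ) ^ m * (k₀ ^ 2 + frameLevel μ K (WithLp.toLp 2 p) ^ 2)) * Z p : ℝ) : ℂ) := fun k₀ p => by rw [hΦdef]
  obtain ⟨Gs, hGsdef⟩ : ∃ Gs : TorusSite 1 (2 * M) × TorusSite 2 L → ℂ, Gs = fun q =>
    bgmFatMultiplier L M e₀ β (nambuXiCT L μ K) (m + 1) ω (⟨(q.1 0).val, ZMod.val_lt (q.1 0)⟩, q.2) *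
      bgmFatMultiplier L M e₀ β (nambuXiCT L μ K) (m + 1) ω (⟨(q.1 0).val, ZMod.val_lt (q.1 0)⟩, q.2) := ⟨_, rfl⟩
  have hGsΦ : ∀ q, Gs q = Φ (π * (1 - 2 * M) / β + 2 * π / β * (((q.1 0).val : ℕ) : ℝ), fun j => 2 * π / L * (((q.2 j).valMinAbs : ℤ) : ℝ)) := by
    intro q; rw [hGsdef]
    subst hS₁
    exact bgmFat_mul_bgmFat_eq_symbol hA he hz h3 m ω ω hZ hΦ q
  have hδ : ∀ a' ∈ S₁, ‖klFermiPoint μ K (sectorCenter (m + 1) a') - klFermiPoint μ K (sectorCenter (m + 1) (ω : ℕ))‖ ≤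
      π * Real.sqrt 2 * (1 + (4 + 2 * A) / (B.Dtmin - 2 * A)) * sectorWidth (m + 1) :=
    fun a' ha' => norm_klFermiPoint_fatNbr_sub_le B hA hlo' hhi' hADt (m + 1) ω (hS₁ ▸ ha')
  have hA0 : 0 ≤ A := (norm_nonneg _).trans (hA 0 0 (by norm_num))
  have hδF0 : 0 ≤ π * Real.sqrt 2 * (1 + (4 + 2 * A) / (B.Dtmin - 2 * A)) * sectorWidth (m + 1) := by
    have := sectorWidth_pos (m + 1); positivity
  have hNs := card_support_fatPair_le B hA hADt he hz hz1 hgap hlo hhi hβ hρA (le_refl m) hδF0 hδ hd hd1 hd2 hZ hΦ hGsΦ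
  -- the injection `k ↦ (val⁻¹ k₁, k⃗)`
  refine le_trans ?_ hNs
  have hinj : ((univ : Finset (FreqMomentum L M)).filter fun k => bgmFatMultiplier L M e₀ β (nambuXiCT L μ K) (m + 1) ω k ≠ 0).card ≤
      ((univ : Finset (TorusSite 1 (2 * M) × TorusSite 2 L)).filter fun q => Gs q ≠ 0).card := by
    refine Finset.card_le_card_of_injOn (fun k => ((fun _ : Fin 1 => (((k.1 : ℕ) : ZMod (2 * M)))), k.2)) (fun k hk => ?_)
      (fun k _ k' _ h => ?_)
    · rw [Finset.mem_coe, mem_filter] at hk ⊢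
      refine ⟨mem_univ _, ?_⟩
      rw [hGsdef]
      dsimp only
      rw [sampledIdx_of_natCast]
      exact mul_ne_zero hk.2 hk.2
    · simp only [Prod.mk.injEq] at h
      obtain ⟨h1, h2⟩ := h
      have h1' := congrFun h1 0
      have hv : (k.1 : ℕ) = (k'.1 : ℕ) := by
        have := congrArg ZMod.val h1'
        simpa only [ZMod.val_natCast, Nat.mod_eq_of_lt k.1.isLt, Nat.mod_eq_of_lt k'.1.isLt] using this
      exact Prod.ext (Fin.ext hv) h2
  exact_mod_cast hinj

include B hA hADt he hz hz1 hgap h3 hlo hhi hβ hρA hd hd1 hd2 in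
/-- **Sector-resolved Gram constant of the sectorised slice on the FAT family** (BGM 2006 (2.80)): for `0 < Λ ≤ Λ′` and every `μ`-frame as in
the fat pack, `IsGramBoundedR (S(Ft)ᵀ·C^K_{(Λ,Λ′]}·S(Ft)) √((βL²)⁻²·N_fat·(2βL²/Λ))`. [cite: BenfattoGiulianiMastropietro2006, §2.8 (2.80)] -/
theorem isGramBoundedR_sliceCT_bgmFat {Λ Λ' : ℝ} (hΛ : 0 < Λ) (hΛΛ' : Λ ≤ Λ') :
    IsGramBoundedR ((sectorSubMatrix L M β (bgmFatMultiplier L M e₀ β (nambuXiCT L μ K) (m + 1))).transpose *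
        hubbardCovSliceCT L M β μ 0 K Λ Λ' * sectorSubMatrix L M β (bgmFatMultiplier L M e₀ β (nambuXiCT L μ K) (m + 1)))
      (Real.sqrt (‖((1 / (β * (L : ℝ) ^ 2) : ℝ) : ℂ)‖ ^ 2 *
        ((klScale e₀ m * β / π + 1) *
          ((Real.sqrt 2 * L * ((klScale e₀ m + (4 + 4 * A) *
              ((klScale e₀ m + B.smax * B.Dtmin * (3 * sectorWidth (m + 1) / 4)) / (B.Dtmin - 2 * A) +
                π * Real.sqrt 2 * (1 + (4 + 2 * A) / (B.Dtmin - 2 * A)) * sectorWidth (m + 1)) ^ 2) / (2 * B.rhomin - 4 * A)) / π + 2) *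
            (Real.sqrt 2 * L * (2 * ((klScale e₀ m + B.smax * B.Dtmin * (3 * sectorWidth (m + 1) / 4)) / (B.Dtmin - 2 * A) +
                π * Real.sqrt 2 * (1 + (4 + 2 * A) / (B.Dtmin - 2 * A)) * sectorWidth (m + 1))) / π + 2)) *
          (2 * (β * (L : ℝ) ^ 2) / Λ)))) := by
  refine isGramBoundedR_sectorSub_sliceCT_of_count hβ μ K hΛ hΛΛ' (bgmFatMultiplier L M e₀ β (nambuXiCT L μ K) (m + 1))
    (fun ω k => norm_bgmFatMultiplier_le_one e₀ β (nambuXiCT L μ K) (m + 1) ω k)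
    fun ω => le_trans ?_ (card_support_bgmFat_le (L := L) (M := M) B hA hADt he hz hz1 hgap h3 hlo hhi hβ hρA m hd hd1 hd2 ω)
  exact_mod_cast Finset.card_le_card (fun k hk => by rw [mem_filter] at hk ⊢; exact ⟨hk.1, hk.2.1⟩)

include B hA hADt he hz hz1 hgap h3 hlo hhi hβ hρA hd hd1 hd2 in
/-- **Entry (sup) bound of the sectorised slice on the FAT family**: every entry of `S(Ft)ᵀ·C^K_{(Λ,Λ′]}·S(Ft)` is at most
`(βL²)⁻²·N_fat·(2βL²/Λ)`. [cite: BenfattoGiulianiMastropietro2006, §2.7 (2.66)–(2.67)] -/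
theorem norm_entry_sliceCT_bgmFat_le {Λ Λ' : ℝ} (hΛ : 0 < Λ) (hΛΛ' : Λ ≤ Λ')
    (Y Y' : SpaceTimeIdx L M × SectorLeg (sectorCount (m + 1))) :
    ‖((sectorSubMatrix L M β (bgmFatMultiplier L M e₀ β (nambuXiCT L μ K) (m + 1))).transpose *
        hubbardCovSliceCT L M β μ 0 K Λ Λ' * sectorSubMatrix L M β (bgmFatMultiplier L M e₀ β (nambuXiCT L μ K) (m + 1))) Y Y'‖ ≤
      ‖((1 / (β * (L : ℝ) ^ 2) : ℝ) : ℂ)‖ ^ 2 *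
        ((klScale e₀ m * β / π + 1) *
          ((Real.sqrt 2 * L * ((klScale e₀ m + (4 + 4 * A) *
              ((klScale e₀ m + B.smax * B.Dtmin * (3 * sectorWidth (m + 1) / 4)) / (B.Dtmin - 2 * A) +
                π * Real.sqrt 2 * (1 + (4 + 2 * A) / (B.Dtmin - 2 * A)) * sectorWidth (m + 1)) ^ 2) / (2 * B.rhomin - 4 * A)) / π + 2) *
            (Real.sqrt 2 * L * (2 * ((klScale e₀ m + B.smax * B.Dtmin * (3 * sectorWidth (m + 1) / 4)) / (B.Dtmin - 2 * A) +
                π * Real.sqrt 2 * (1 + (4 + 2 * A) / (B.Dtmin - 2 * A)) * sectorWidth (m + 1))) / π + 2)) *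
          (2 * (β * (L : ℝ) ^ 2) / Λ)) := by
  refine norm_sectorSub_sliceCT_le_of_count hβ μ K hΛ hΛΛ' (bgmFatMultiplier L M e₀ β (nambuXiCT L μ K) (m + 1))
    (fun ω k => norm_bgmFatMultiplier_le_one e₀ β (nambuXiCT L μ K) (m + 1) ω k)
    (fun ω => le_trans ?_ (card_support_bgmFat_le (L := L) (M := M) B hA hADt he hz hz1 hgap h3 hlo hhi hβ hρA m hd hd1 hd2 ω)) Y Y'
  exact_mod_cast Finset.card_le_card (fun k hk => by rw [mem_filter] at hk ⊢; exact ⟨hk.1, hk.2.1⟩)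

end FatGram

/-! ## The closed form `κ_n² ≤ 2·C_N·Λ/N_r = 2C_N·e₀·8^{-(m+1)}` in the regime of …AlphaFatClosed -/

/-- **`κ_n²` in closed form** (pure real algebra on top of `fatSupport_le`): with `Λ_m = 4Λ`, `π ≤ Λ_mβ`, `Λ_m + K_pρ_f² ≤ Λc₁`, `ρ_f ≤ c_ρπ/N_r`
and the two `+2`-thresholds, `(βL²)⁻²·N_fat·(2βL²/Λ) ≤ 2·(128c₁c_ρ/(π²γ))·Λ/N_r`. [cite: BenfattoGiulianiMastropietro2006, §2.8 (2.80)] -/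
theorem gramConst_sq_bgmFat_closed {Λ Λm β L γ Kp ρf cρ c₁ Nr : ℝ} (hΛ : 0 < Λ) (hβ : 0 < β) (hL : 0 < L) (hγ : 0 < γ) (hNr : 0 < Nr)
    (hc₁ : 0 ≤ c₁) (hΛm : Λm = 4 * Λ) (hπ : Real.pi ≤ Λm * β) (hsh : Λm + Kp * ρf ^ 2 ≤ Λ * c₁) (hρfb : ρf ≤ cρ * Real.pi / Nr)
    (hKρ : 0 ≤ Kp * ρf ^ 2)
    (hY₁ : 2 ≤ Real.sqrt 2 * L * ((Λm + Kp * ρf ^ 2) / γ) / Real.pi) (hY₂ : 2 ≤ Real.sqrt 2 * L * (2 * ρf) / Real.pi) :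
    (1 / (β * L ^ 2)) ^ 2 *
        ((Λm * β / Real.pi + 1) * ((Real.sqrt 2 * L * ((Λm + Kp * ρf ^ 2) / γ) / Real.pi + 2) * (Real.sqrt 2 * L * (2 * ρf) / Real.pi + 2)) *
          (2 * (β * L ^ 2) / Λ)) ≤
      2 * (128 * c₁ * cρ / (Real.pi ^ 2 * γ)) * Λ / Nr := by
  have hNs := fatSupport_le hΛ hβ hL hγ hNr hc₁ hΛm hπ hsh hρfb hKρ hY₁ hY₂
  have hpos : 0 ≤ (1 / (β * L ^ 2)) ^ 2 * (2 * (β * L ^ 2) / Λ) := by positivity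
  calc (1 / (β * L ^ 2)) ^ 2 *
        ((Λm * β / Real.pi + 1) * ((Real.sqrt 2 * L * ((Λm + Kp * ρf ^ 2) / γ) / Real.pi + 2) * (Real.sqrt 2 * L * (2 * ρf) / Real.pi + 2)) *
          (2 * (β * L ^ 2) / Λ))
      = ((1 / (β * L ^ 2)) ^ 2 * (2 * (β * L ^ 2) / Λ)) *
          ((Λm * β / Real.pi + 1) * ((Real.sqrt 2 * L * ((Λm + Kp * ρf ^ 2) / γ) / Real.pi + 2) * (Real.sqrt 2 * L * (2 * ρf) / Real.pi + 2))) := by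
        ring
    _ ≤ ((1 / (β * L ^ 2)) ^ 2 * (2 * (β * L ^ 2) / Λ)) * (128 * c₁ * cρ / (Real.pi ^ 2 * γ) * (β * L ^ 2 * Λ ^ 2 / Nr)) :=
        mul_le_mul_of_nonneg_left hNs hpos
    _ = 2 * (128 * c₁ * cρ / (Real.pi ^ 2 * γ)) * Λ / Nr := by field_simp

/-- **The scaling**: with `Λ = e₀·(4^{m+1})⁻¹` and `N_r = 2^{m+1}`, `Λ/N_r = e₀·(8^{m+1})⁻¹` — BGM's `γ^{3h/2}` per pair of fields.
[cite: BenfattoGiulianiMastropietro2006, §2.8 (2.80)] -/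
theorem klScale_div_two_pow (e₀ : ℝ) (m : ℕ) : klScale e₀ (m + 1) / (2 : ℝ) ^ (m + 1) = e₀ * ((8 : ℝ) ^ (m + 1))⁻¹ := by
  rw [klScale]
  have h8 : (8 : ℝ) ^ (m + 1) = (4 : ℝ) ^ (m + 1) * (2 : ℝ) ^ (m + 1) := by
    rw [← mul_pow]; norm_num
  rw [h8, mul_inv]
  field_simp

end Summit.HubbardSuperconductivity.HubbardSuperconductivity.Theorems.TorusFourierL2

end
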